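import Summits.CriticalPhenomena.Ising3DConformalLimit.Theorems.PrimaryAtInfinityTwoPointPowerLawEta
import Summits.CriticalPhenomena.Ising3DConformalLimit.Theses.HyperoctahedralRP
import Summits.CriticalPhenomena.Ising3DConformalLimit.Theses.OrthogonalFrameTP2
import Summits.CriticalPhenomena.Ising3DConformalLimit.Theses.UnitLightCone
import HarnessLib

/-!
# Line `eta-free-split` for crux stmt-CriticalPhenomena-0636 (`IsingEuclidUpgradeR4NonGaussian`)
(ALTERNATIVE line of the crux strategist, gen s1, 2026-08-17; the live skeleton
`Lines/isotherm_saturation_lee_yang.lean` is NOT replaced — the two stubs below are registered with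
`workitem stub-add`.)

**Idea.** Since 2026-08-17 the tree PROVES, for every non-degenerate pointwise scaling limit of the
critical `ℤ³` correlators (`twoPoint_structure_of_limit`): the normalised limit is translation
invariant and scale covariant with `Δ ∈ [1/2, 3/4]`, its two-point function is the ISOTROPIC pure
power `s‖a−b‖^{−2Δ}`, `η = 2Δ − 1` exists, and — the edge-Gaussianity theorem
`half_lt_delta_of_hasNontrivialU4` (potential theory at the unitarity bound: exterior harmonicity,
Kelvin, Bôcher, Liouville) — `Δ = 1/2 ⇒ U₄ ≡ 0`. Hence the crux FACTORS EXACTLY: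

  `IsingEuclidUpgradeR4NonGaussian ⟺ TwoPointPowerLawEta ∧ GaussianLimitIsFree`

* S1 `stub_twoPointPowerLawEta` = the EXISTING crux `PrimaryAtInfinity.TwoPointPowerLawEta`
  (item stmt-CriticalPhenomena-5354, staffed): every non-degenerate limit has `S₂ = c‖a−b‖^{−2Δ}`
  with `Δ > 1/2`; by `twoPointPowerLawEta_iff_half_lt_delta` its whole residual content is
  `Δ > 1/2`, i.e. **η > 0 in limit form** — a statement about the TWO-point function only, implied
  by the lattice bound `EtaPositive` (item 2600) and by `¬ HasIsingExponentEta 3 0` (¬ item 15521);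
* S2 `stub_gaussianLimitIsFree` = the EXISTING crux `AnomalousForcesInteraction.GaussianLimitIsFree`
  (item stmt-CriticalPhenomena-2601, staffed): a non-degenerate, translation-invariant,
  scale-covariant limit with `U₄ ≡ 0` has `Δ = 1/2` — **no anomalous generalised free field**
  (`Δ ∈ (1/2, 3/4]`, Wick) arises from n.n. Ising₃; engine: Markov inheritance + Pitt–Kotani–Rozanov
  (route MarkovRigidity / AnomalousForcesInteraction), or any Gaussian-world rigidity
  (GammaForcesInteraction `GaussianNoPowerDeficiency`, EnergyNotSigmaSquared, LeeYangGap).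

Composition `IsingEuclidUpgradeR4NonGaussian_of : S1 → S2 → crux` (sorry-free, 15 lines): normalise
`S` off `NonCoincident`; S1 gives `Δ > 1/2`; were `U₄ ≡ 0`, S2 would give `Δ = 1/2`. Both stubs are
NECESSARY (crux ⇒ S1 is the landed `twoPointPowerLawEta_of_nonGaussian'`; crux ⇒ S2 vacuously), so
neither is the crux reworded: the anomalous GFF satisfies S1 and violates the crux, the free field
`Δ = 1/2` satisfies S2 and violates the crux. The identical glue, with the iff and the lattice
entrances, is attached as item evidence `IsingEuclidUpgradeR4NonGaussianEtaFreeSplit.lean`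
(planner cannot land Theorems; any prover may).
-/

noncomputable section

namespace Summit.CriticalPhenomena.Ising3DConformalLimit.Cruxes.IsingEuclidUpgradeR4NonGaussian.EtaFreeSplitLine

open Literature.Probability.LatticeModels Filter Set
open scoped Topology
open Summit.CriticalPhenomena.Ising3DConformalLimit.Theses
open Summit.CriticalPhenomena.Ising3DConformalLimit.MoebiusLimitExistsNegative
  (normalised_hasLimit normalised_nondeg hasNontrivialU4_normalised_iff exists_scaleCovariant_normalised
   isTranslationInvariant_normalised_of_limit)
open Summit.CriticalPhenomena.Ising3DConformalLimit.Theorems.PrimaryAtInfinityTwoPointPowerLawEta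
  (twoPointPowerLawEta_iff_half_lt_delta)

/-! ## Registered stubs (the two statements of the line; both are EXISTING staffed items, by name) -/

/-- **S1 — η > 0 IN LIMIT FORM** (OPEN; = item stmt-CriticalPhenomena-5354
`PrimaryAtInfinity.TwoPointPowerLawEta`, by name): every non-degenerate pointwise scaling limit of
`criticalCorr 3` has two-point function `c‖a − b‖^{−2Δ}` with `c > 0` and `Δ > 1/2`. Isotropy and the
pure power law are landed theorems (`twoPoint_structure_of_limit`); the open content is `Δ > 1/2`,
i.e. the exclusion of the canonical (free, `η = 0`) two-point exponent for Ising₃ limits. -/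
theorem stub_twoPointPowerLawEta : PrimaryAtInfinity.TwoPointPowerLawEta := by
  sorry

/-- **S2 — A GAUSSIAN LIMIT IS FREE** (OPEN; = item stmt-CriticalPhenomena-2601
`AnomalousForcesInteraction.GaussianLimitIsFree`, by name): a non-degenerate, translation-invariant,
scale-covariant (dimension `Δ`) pointwise limit of `criticalCorr 3` with `U₄ ≡ 0` off the diagonals
has `Δ = 1/2`. -/
theorem stub_gaussianLimitIsFree : AnomalousForcesInteraction.GaussianLimitIsFree := by
  sorry

/-! ## Composition (sorry-free) -/

open Classical in
/-- **COMPOSITION.** S1 and S2 give the crux `IsingEuclidUpgradeR4NonGaussian` — the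
IsingEuclidUpgrade decl of item stmt-CriticalPhenomena-0636, by name. Normalise `S` off
`NonCoincident` (same limit and `U₄`; translation invariant; scale covariant with some `Δ`, all
landed); S1 through `twoPointPowerLawEta_iff_half_lt_delta` gives `1/2 < Δ`; if `U₄ ≡ 0`, S2 gives
`Δ = 1/2` — contradiction. -/
theorem IsingEuclidUpgradeR4NonGaussian_of :
    PrimaryAtInfinity.TwoPointPowerLawEta → AnomalousForcesInteraction.GaussianLimitIsFree →
      IsingEuclidUpgrade.IsingEuclidUpgradeR4NonGaussian := by
  intro h₁ h₂ ρ S hρ hlim hnd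
  have h₁' := twoPointPowerLawEta_iff_half_lt_delta.1 h₁
  have hlim' := normalised_hasLimit hlim
  have hnd' := normalised_nondeg hnd
  have htr' := isTranslationInvariant_normalised_of_limit hlim
  obtain ⟨Δ, -, hsc'⟩ := exists_scaleCovariant_normalised hρ hlim hnd
  have hΔ : 1 / 2 < Δ := h₁' ρ S Δ hρ hlim hnd hsc'
  by_contra hU4
  have hU4' : ¬ HasNontrivialU4 (fun n x => if x ∈ NonCoincident 3 n then S n x else 0) :=
    fun h => hU4 (hasNontrivialU4_normalised_iff.1 h)
  have hhalf : Δ = 1 / 2 := h₂ ρ Δ _ hρ hlim' hnd' htr' hsc' hU4'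
  exact absurd hΔ (by rw [hhalf]; exact lt_irrefl _)

/-- **COMPOSITION** for the HyperoctahedralRP copy of the shared decl (primary route of the crux
chain; definitionally the same statement). -/
theorem IsingEuclidUpgradeR4NonGaussian_of_hyperoctahedralRP :
    PrimaryAtInfinity.TwoPointPowerLawEta → AnomalousForcesInteraction.GaussianLimitIsFree →
      HyperoctahedralRP.IsingEuclidUpgradeR4NonGaussian :=
  fun h₁ h₂ => IsingEuclidUpgradeR4NonGaussian_of h₁ h₂

/-- **COMPOSITION** for the OrthogonalFrameTP2 copy (bet route of this strategist seat). -/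
theorem IsingEuclidUpgradeR4NonGaussian_of_orthogonalFrameTP2 :
    PrimaryAtInfinity.TwoPointPowerLawEta → AnomalousForcesInteraction.GaussianLimitIsFree →
      OrthogonalFrameTP2.IsingEuclidUpgradeR4NonGaussian :=
  fun h₁ h₂ => IsingEuclidUpgradeR4NonGaussian_of h₁ h₂

/-- **COMPOSITION** for the UnitLightCone copy. -/
theorem IsingEuclidUpgradeR4NonGaussian_of_unitLightCone :
    PrimaryAtInfinity.TwoPointPowerLawEta → AnomalousForcesInteraction.GaussianLimitIsFree →
      UnitLightCone.IsingEuclidUpgradeR4NonGaussian :=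
  fun h₁ h₂ => IsingEuclidUpgradeR4NonGaussian_of h₁ h₂

/-- The crux from the registered stubs (what closes when items 5354 and 2601 close). -/
theorem IsingEuclidUpgradeR4NonGaussian_of_stubs :
    IsingEuclidUpgrade.IsingEuclidUpgradeR4NonGaussian :=
  IsingEuclidUpgradeR4NonGaussian_of stub_twoPointPowerLawEta stub_gaussianLimitIsFree

end Summit.CriticalPhenomena.Ising3DConformalLimit.Cruxes.IsingEuclidUpgradeR4NonGaussian.EtaFreeSplitLine

end
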